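import Mathlib
import Summits.KontsevichZagierPeriods.Zeta5Search.BrickPhiAllPrimes

/-!
# BrickFrobeniusAllPrimes — the one-step Frobenius comparison (B1) of the Laurent cells of the brick kernels at EVERY
prime, `p = 2` included: `p^d·c(np, Kp, d) = (−1)^{n(p−1)B}·p^ε·Σ_{m+e=d} φ_m·c(n, K, e)` (cell `pub-zeta5`, seat ct-1 g42)

HONEST FRAMING: systematic search; no irrationality claim unless certified.  INSTRUMENT identities between the Laurent
coefficients `laurent A B ε n K d = [T^d](T^A·R_n(−K+T))` of the brick kernels `R_n^{(A,B,ε)}` (`BrickLaurent`) at two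
consecutive digit levels; nothing about `ζ(5)`/`ζ(3)`; no `γ`/denominator-law/record statement; records in print UNMOVED;
NOTHING IS DISCHARGED (net named-fact debt 0).

The tree's `BrickLaurent.frobenius_poly / laurentSeries_frobenius / laurent_frobenius / cell_frobenius` — the engine
«(B1)» of every level induction of the zeta5-irr chain (`BrickLevelReduction*`, `BrickPropositionHInf`) — carry `p ≠ 2`
ONLY because they consume `BrickPhiTaylor.brickPhi_neg_add_eq`, whose `N/D` representation of `Φ_{n,p}(−K+T)` drops
the sign `∏_{p∤ℓ≤np}(−1) = (−1)^{n(p−1)}`.  With the sign-complete representation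
`BrickPhiAllPrimes.brickPhi_neg_add_eq_sign` (`Φ_{n,p}(−K+T) = (−1)^{n(p−1)B}·N(T)/D(T)`, EVERY prime) the same three
steps go through verbatim with the factor `σ = (−1)^{n(p−1)B}` carried along (`σ = 1` for odd `p`, `σ = (−1)^{nB}` at
`p = 2`); the regular-part identity `BrickTopFrobenius.topFun_frobenius` behind them is already prime-free.

* `frobenius_poly_sign` — the polynomial identity `L_N·D·tD = σ·p^ε·L_D·N·tN` in `ℚ[T]`;
* `laurentSeries_frobenius_sign` — `rescale_p(F^{(np)}_{Kp}) = C(σ p^ε)·Φ-series·F^{(n)}_K` in `ℚ⟦T⟧`;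
* **`laurent_frobenius_sign`** — `p^d·laurent(np, Kp, d) = σ·p^ε·Σ_{(m,e) ∈ antidiagonal d} φ_m·laurent(n, K, e)`;
* **`cell_frobenius_sign`** — `p^{A−s}·c_{Kp,s}(np) = σ·p^ε·Σ_{m=0}^{A−s} φ_m·c_{K,s+m}(n)`;
* `cell_frobenius_two` — `p = 2`: `2^{A−s}·c_{2K,s}(2n) = (−1)^{nB}·2^ε·Σ_{m=0}^{A−s} φ_m·c_{K,s+m}(n)`, where (by
  `BrickPhiAllPrimes`) `φ_0` is a `2`-adic unit and `φ_m ∈ 2^mℤ_(2)`;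
* `padicValuation_pow_mul_cell_mul_prime_le` — the valuation form at every prime:
  `v_p(p^{A−s}c_{Kp,s}(np)) ≤ p^{−ε}·max_m v_p(φ_m)·v_p(c_{K,s+m}(n)) ≤ p^{−ε}·max_m p^{−m}·v_p(c_{K,s+m}(n))`.

Theorems only (0 `def`); tree vocabulary; nothing restated (the odd-`p` theorems of `BrickLaurent` are the case `σ = 1`).
-/

namespace Summit.KontsevichZagierPeriods.Zeta5Search.BrickFrobeniusAllPrimes

open Finset Nat Polynomial WithZero
open Summit.KontsevichZagierPeriods.Zeta5Search.BrickKernelFrobenius (brickPhi)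
open Summit.KontsevichZagierPeriods.Zeta5Search.BrickTopCoefficient (topFun)
open Summit.KontsevichZagierPeriods.Zeta5Search.BrickTopFrobenius (topFun_frobenius)
open Summit.KontsevichZagierPeriods.Zeta5Search.BrickPhiTaylor (phiNum phiDen)
open Summit.KontsevichZagierPeriods.Zeta5Search.BrickLaurent (expandAt laurentSeries laurent cell kerNum kerDenErase
  phiSeries phiCoeff topFun_eq_div eval_kerDenErase_neg_ne_zero aeval_eq_eval_map eval_phiDen_zero_ne_zero
  coe_comp_C_mul_X rescale_inv constantCoeff_coe_taylor)
open Summit.KontsevichZagierPeriods.Zeta5Search.BrickPhiAllPrimes (brickPhi_neg_add_eq_sign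
  padicValuation_phiCoeff_le_exp_neg)

noncomputable section

section frobenius

variable {p : ℕ} (hp : p.Prime) {A B : ℕ} (hAB : 2 * B ≤ A) (ε : ℕ) {n K : ℕ} (hK : K ≤ n)
include hp hAB hK

/-- The polynomial identity behind (B1) at EVERY prime: with `a = −Kp`, `L_N = taylor_a(kerNum_{np})(pT)`,
`L_D = taylor_a(kerDenErase_{np,Kp})(pT)`, `σ·N/D = Φ_{n,p}(−K+T)` (`σ = (−1)^{n(p−1)B}`) and `tN/tD = g_K(−K+T)`:
`L_N · D · tD = σ·p^ε · L_D · N · tN` in `ℚ[T]`. -/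
theorem frobenius_poly_sign :
    (taylor (-((K * p : ℕ) : ℚ)) (kerNum A B ε (n * p))).comp (C (p : ℚ) * X) *
        (phiDen A p n K).map (Int.castRingHom ℚ) * taylor (-(K : ℚ)) (kerDenErase A n K) =
      C ((-1) ^ (n * (p - 1) * B) * (p : ℚ) ^ ε) *
        (taylor (-((K * p : ℕ) : ℚ)) (kerDenErase A (n * p) (K * p))).comp (C (p : ℚ) * X) *
        (phiNum A B p n K).map (Int.castRingHom ℚ) * taylor (-(K : ℚ)) (kerNum A B ε n) := by
  set LD := (taylor (-((K * p : ℕ) : ℚ)) (kerDenErase A (n * p) (K * p))).comp (C (p : ℚ) * X) with hLD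
  set PD := (phiDen A p n K).map (Int.castRingHom ℚ) with hPD
  set tD := taylor (-(K : ℚ)) (kerDenErase A n K) with htD
  have hpQ : (p : ℚ) ≠ 0 := by exact_mod_cast hp.ne_zero
  have hG : LD * PD * tD ≠ 0 := by
    intro h
    have h0 := congrArg (eval (0 : ℚ)) h
    rw [eval_mul, eval_mul, eval_zero] at h0
    rcases mul_eq_zero.1 h0 with h0 | h0
    · rcases mul_eq_zero.1 h0 with h0 | h0
      · rw [hLD, eval_comp, eval_mul, eval_C, eval_X, mul_zero, taylor_eval, zero_add] at h0
        exact eval_kerDenErase_neg_ne_zero A (n * p) (K * p) h0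
      · exact eval_phiDen_zero_ne_zero A p n K h0
    · rw [htD, taylor_eval, zero_add] at h0
      exact eval_kerDenErase_neg_ne_zero A n K h0
  apply Polynomial.eq_of_infinite_eval_eq
  refine Set.Infinite.mono (s := {T : ℚ | ¬ (LD * PD * tD).IsRoot T}) (fun T hT => ?_)
    (Polynomial.finite_setOf_isRoot hG).infinite_compl
  have hT' : eval T (LD * PD * tD) ≠ 0 := hT
  rw [eval_mul, eval_mul] at hT'
  have hT1 : eval T LD ≠ 0 := fun h => hT' (by rw [h, zero_mul, zero_mul])
  have hT2 : eval T PD ≠ 0 := fun h => hT' (by rw [h, mul_zero, zero_mul])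
  have hT3 : eval T tD ≠ 0 := fun h => hT' (by rw [h, mul_zero])
  show eval T _ = eval T _
  have hfun := topFun_frobenius (K := ℚ) hAB ε hp.pos hpQ hK (-(K : ℚ) + T)
  have e1 : topFun A B ε (n * p) (K * p) ((p : ℚ) * (-(K : ℚ) + T)) =
      ((taylor (-((K * p : ℕ) : ℚ)) (kerNum A B ε (n * p))).comp (C (p : ℚ) * X)).eval T / LD.eval T := by
    rw [topFun_eq_div, hLD, eval_comp, eval_comp, eval_mul, eval_C, eval_X, taylor_eval, taylor_eval]
    congr 2 <;> (push_cast; ring)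
  have e2 : brickPhi A B p n (-(K : ℚ) + T) =
      (-1) ^ (n * (p - 1) * B) * (((phiNum A B p n K).map (Int.castRingHom ℚ)).eval T / PD.eval T) := by
    rw [hPD, ← aeval_eq_eval_map, ← aeval_eq_eval_map, ← brickPhi_neg_add_eq_sign hp, Int.cast_natCast]
  have e3 : topFun A B ε n K (-(K : ℚ) + T) = (taylor (-(K : ℚ)) (kerNum A B ε n)).eval T / tD.eval T := by
    rw [topFun_eq_div, htD, taylor_eval, taylor_eval, add_comm]
  rw [e1, e2, e3, div_eq_iff hT1] at hfun
  rw [eval_mul, eval_mul, hfun, eval_mul, eval_mul, eval_mul, eval_C]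
  field_simp

/-- **(B1) as an identity of power series at EVERY prime**: `rescale_p(F^{(np)}_{Kp}) = C(σ·p^ε)·Φ-series·F^{(n)}_K` in
`ℚ⟦T⟧` (`σ = (−1)^{n(p−1)B}`), i.e. `F^{(np)}_{Kp}(pT) = σ·p^ε·(N/D)(T)·F^{(n)}_K(T)` with `σ·(N/D)(T) = Φ_{n,p}(−K+T)`. -/
theorem laurentSeries_frobenius_sign :
    PowerSeries.rescale (p : ℚ) (laurentSeries A B ε (n * p) (K * p)) =
      PowerSeries.C ((-1) ^ (n * (p - 1) * B) * (p : ℚ) ^ ε) * phiSeries A B p n K * laurentSeries A B ε n K := by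
  have hpoly := congrArg (fun P : ℚ[X] => (P : PowerSeries ℚ)) (frobenius_poly_sign hp hAB ε hK)
  simp only [Polynomial.coe_mul, coe_comp_C_mul_X, Polynomial.coe_C] at hpoly
  set LN := PowerSeries.rescale (p : ℚ) ((taylor (-((K * p : ℕ) : ℚ)) (kerNum A B ε (n * p)) : ℚ[X]) :
    PowerSeries ℚ) with hLN
  set LD := PowerSeries.rescale (p : ℚ) ((taylor (-((K * p : ℕ) : ℚ)) (kerDenErase A (n * p) (K * p)) : ℚ[X]) :
    PowerSeries ℚ) with hLD
  set PN := (((phiNum A B p n K).map (Int.castRingHom ℚ) : ℚ[X]) : PowerSeries ℚ) with hPN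
  set PD := (((phiDen A p n K).map (Int.castRingHom ℚ) : ℚ[X]) : PowerSeries ℚ) with hPD
  set tN := ((taylor (-(K : ℚ)) (kerNum A B ε n) : ℚ[X]) : PowerSeries ℚ) with htN
  set tD := ((taylor (-(K : ℚ)) (kerDenErase A n K) : ℚ[X]) : PowerSeries ℚ) with htD
  set c : ℚ := (-1) ^ (n * (p - 1) * B) * (p : ℚ) ^ ε with hc
  have hLD0 : PowerSeries.constantCoeff LD ≠ 0 := by
    rw [hLD, ← PowerSeries.coeff_zero_eq_constantCoeff_apply, PowerSeries.coeff_rescale, pow_zero, one_mul,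
      PowerSeries.coeff_zero_eq_constantCoeff_apply, constantCoeff_coe_taylor]
    exact eval_kerDenErase_neg_ne_zero A (n * p) (K * p)
  have hPD0 : PowerSeries.constantCoeff PD ≠ 0 := by
    rw [hPD, Polynomial.constantCoeff_coe, coeff_zero_eq_eval_zero]
    exact eval_phiDen_zero_ne_zero A p n K
  have htD0 : PowerSeries.constantCoeff tD ≠ 0 := by
    rw [htD, constantCoeff_coe_taylor]; exact eval_kerDenErase_neg_ne_zero A n K
  have hL : PowerSeries.rescale (p : ℚ) (laurentSeries A B ε (n * p) (K * p)) = LN * LD⁻¹ := by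
    rw [laurentSeries, expandAt, map_mul, rescale_inv _ (by
      rw [constantCoeff_coe_taylor]; exact eval_kerDenErase_neg_ne_zero A (n * p) (K * p))]
  have hΦ : phiSeries A B p n K = PN * PD⁻¹ := by
    rw [phiSeries, expandAt, taylor_zero, taylor_zero]
  have hR : laurentSeries A B ε n K = tN * tD⁻¹ := rfl
  rw [hL, hΦ, hR]
  have hne : LD * PD * tD ≠ 0 := by
    refine mul_ne_zero (mul_ne_zero ?_ ?_) ?_ <;> intro h <;> [apply hLD0; apply hPD0; apply htD0] <;>
      rw [h, map_zero]
  apply mul_right_cancel₀ hne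
  calc LN * LD⁻¹ * (LD * PD * tD) = LN * PD * tD * (LD⁻¹ * LD) := by ring
    _ = LN * PD * tD := by rw [PowerSeries.inv_mul_cancel _ hLD0, mul_one]
    _ = PowerSeries.C c * LD * PN * tN := hpoly
    _ = PowerSeries.C c * LD * PN * tN * (PD⁻¹ * PD) * (tD⁻¹ * tD) := by
        rw [PowerSeries.inv_mul_cancel _ hPD0, PowerSeries.inv_mul_cancel _ htD0, mul_one, mul_one]
    _ = PowerSeries.C c * (PN * PD⁻¹) * (tN * tD⁻¹) * (LD * PD * tD) := by ring

/-- **(B1) at every depth and EVERY prime**: for `2B ≤ A`, `K ≤ n` and every `d`,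
`p^d · laurent(np, Kp, d) = (−1)^{n(p−1)B}·p^ε · Σ_{m+e=d} φ_m · laurent(n, K, e)`. -/
theorem laurent_frobenius_sign (d : ℕ) :
    (p : ℚ) ^ d * laurent A B ε (n * p) (K * p) d =
      (-1) ^ (n * (p - 1) * B) * (p : ℚ) ^ ε *
        ∑ x ∈ antidiagonal d, phiCoeff A B p n K x.1 * laurent A B ε n K x.2 := by
  have h := congrArg (PowerSeries.coeff d) (laurentSeries_frobenius_sign hp hAB ε hK)
  rw [PowerSeries.coeff_rescale, mul_assoc, PowerSeries.coeff_C_mul, PowerSeries.coeff_mul] at h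
  simpa only [laurent, phiCoeff] using h

/-- **(B1) in zi-p2's indexing at EVERY prime** (`1 ≤ s ≤ A`):
`p^{A−s} · c_{Kp,s}(np) = (−1)^{n(p−1)B}·p^ε · Σ_{m=0}^{A−s} φ_m · c_{K,s+m}(n)`. -/
theorem cell_frobenius_sign (s : ℕ) :
    (p : ℚ) ^ (A - s) * cell A B ε (n * p) (K * p) s =
      (-1) ^ (n * (p - 1) * B) * (p : ℚ) ^ ε *
        ∑ m ∈ range (A - s + 1), phiCoeff A B p n K m * cell A B ε n K (s + m) := by
  rw [cell, laurent_frobenius_sign hp hAB ε hK (A - s), Finset.Nat.sum_antidiagonal_eq_sum_range_succ_mk]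
  congr 1
  refine Finset.sum_congr rfl fun m _ => ?_
  rw [cell, Nat.sub_add_eq]

/-- **The valuation form of (B1) at EVERY prime**: `v_p(p^{A−s}·c_{Kp,s}(np)) ≤ p^{−ε}·max_{m ≤ A−s} p^{−m}·v_p(c_{K,s+m}(n))`
(`φ_m ∈ p^mℤ_(p)` by `BrickPhiAllPrimes.padicValuation_phiCoeff_le_exp_neg`; the sign is a unit).  At `p = 2` this is the
one-step descent bound of the even poles with no hypothesis on `p`. -/
theorem padicValuation_pow_mul_cell_le [Fact p.Prime] (s : ℕ) {b : ℤᵐ⁰}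
    (hb : ∀ m, m ≤ A - s → exp (-(m : ℤ)) * Rat.padicValuation p (cell A B ε n K (s + m)) ≤ b) :
    Rat.padicValuation p ((p : ℚ) ^ (A - s) * cell A B ε (n * p) (K * p) s) ≤ exp (-(ε : ℤ)) * b := by
  rw [cell_frobenius_sign hp hAB ε hK s, map_mul, map_mul, map_pow, Valuation.map_neg, map_one, one_pow, one_mul, map_pow,
    Rat.padicValuation_self, ← exp_nsmul, nsmul_eq_mul, mul_neg_one]
  refine mul_le_mul' le_rfl (Valuation.map_sum_le _ fun m hm => ?_)
  rw [map_mul]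
  exact (mul_le_mul' (padicValuation_phiCoeff_le_exp_neg A B n K m) le_rfl).trans
    (hb m (Nat.lt_succ_iff.1 (mem_range.1 hm)))

end frobenius

/-- `p = 2`: **`2^{A−s}·c_{2K,s}(2n) = (−1)^{nB}·2^ε·Σ_{m=0}^{A−s} φ_m·c_{K,s+m}(n)`** (`2B ≤ A`, `K ≤ n`). -/
theorem cell_frobenius_two {A B : ℕ} (hAB : 2 * B ≤ A) (ε : ℕ) {n K : ℕ} (hK : K ≤ n) (s : ℕ) :
    (2 : ℚ) ^ (A - s) * cell A B ε (n * 2) (K * 2) s =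
      (-1) ^ (n * B) * (2 : ℚ) ^ ε * ∑ m ∈ range (A - s + 1), phiCoeff A B 2 n K m * cell A B ε n K (s + m) := by
  simpa using cell_frobenius_sign Nat.prime_two hAB ε hK s

end

end Summit.KontsevichZagierPeriods.Zeta5Search.BrickFrobeniusAllPrimes
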